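/-
Copyright (c) 2025 Kevin Buzzard. All rights reserved.
Released under Apache 2.0 license as described in the file LICENSE.
Authors: Kevin Buzzard, Salvatore Mercuri
-- (for the material from `FLT/Mathlib/Topology/Algebra/RestrictedProduct/TopologicalSpace.lean`)

Vendored into this tree (Lean v4.32.0 / Mathlib v4.32.0) from the FLT project,
ImperialCollegeLondon/FLT @ 071d16bb51e87165b4f4b5466f14051344bf426b (2026-08-18), Apache-2.0
[FLTProject2025]. Modifications: see the module docstring ("Provenance and modifications").
-/
import Mathlib.Topology.Algebra.ContinuousMonoidHom
import Mathlib.Topology.Algebra.Group.Basic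
import Mathlib.Topology.Algebra.RestrictedProduct.TopologicalSpace
import Literature.NumberTheory.AdelicBaseChange.RestrictedProductEquivs
import HarnessLib

/-!
# Restricted products, topology: continuity of componentwise maps, `flattenHomeomorph`, neighbourhoods, open maps, continuous factor inclusions

Topic `NumberTheory/AdelicBaseChange` — file 10 of the ADELIC BASE-CHANGE PACKET (the FLT project's
proof of `L ⊗[K] K_v ≃ₐ[L] ∏_{w ∣ v} L_w`, `L ⊗[K] 𝔸_K^∞ ≃ₐ[L] 𝔸_L^∞`, `L ⊗[K] 𝔸_K ≃ₐ[L] 𝔸_L`,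
vendored module by module; Cassels–Fröhlich, *Algebraic Number Theory*, Ch. II §10, §14). Needs file 9.
The TOPOLOGICAL counterparts of file 9, restricted to what the base change (files 11, 12, 15) uses:

* `Continuous.restrictedProduct_congrRight`: componentwise maps with continuous components are
  continuous (Mathlib's `mapAlong_continuous`); `RestrictedProduct.coe_sum`, `sum_apply`;
* **`RestrictedProduct.flattenHomeomorph`/`flattenHomeomorph'`**: the regrouping
  `Πʳ j, [Π_{i ∈ f⁻¹ j} G i, Π C i]_[𝒢] ≃ₜ Πʳ i, [G i, C i]_[ℱ]` of file 9 is a homeomorphism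
  (`∏'_v ∏_{w∣v} L_w ≅ 𝔸_L^∞` topologically);
* the neighbourhood bases `mem_nhds_iff_of_principal`, `mem_nhds_of_exists_nhds_of_cofinite`,
  `mem_nhds_iff_of_cofinite` (open `C i`), and `isOpenMap_of_open_components`;
* `singleContinuousAddMonoidHom : A j →ₜ+ Πʳ i, [A i, B i]`, `evalContinuousAddMonoidHom`.

NOT vendored from this FLT file (unused by the base-change chain; several duplicate Mathlib/tree
statements — FLT-INVENTORY §11.4): the box lemmas `isOpen_forall_mem_of_eventually_eq` /
`isCompact_forall_mem_of_eventually_subset` (RP-4), `ContinuousMulEquiv.restrictedProductCongrRight`,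
the product/pi/matrix homeomorphisms and `ContinuousMulEquiv`s (RP-3), `ContinuousMulEquiv.restrictedProductUnits`
with `Submonoid.unitsContinuousMulEquivUnitsType` (RP-1; the tree's `Literature.Topology.Algebra.RestrictedProduct.unitsContinuousMulEquiv`),
second countability (RP-8; in the tree twice: `Automorphic/AdelicSecondCountable`, `MeasureTheory/RestrictedProduct/Borel`),
`Homeomorph/ContinuousMulEquiv.restrictedProductPrincipal`, and the small helper files
`FLT/Mathlib/Topology/Algebra/{Module/Quotient, ContinuousMonoidHom, Group/Units}.lean`,
`FLT/Mathlib/Order/Filter/Cofinite.lean`, `FLT/Mathlib/Topology/Bases.lean` that only those used.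

Everything is PROVED (definitions with bodies + lemmas); no named facts. The STATEMENTS are,
verbatim, those of the published FLT project, so every declaration carries the provenance tag
`[cite: FLTProject2025, <FLT file> · <FLT name>]` (the gate's cited-only rule for `Literature/`).

## Provenance and modifications (Apache-2.0 §4)

Lean source: `FLT/Mathlib/Topology/Algebra/RestrictedProduct/TopologicalSpace.lean` of
ImperialCollegeLondon/FLT at commit `071d16bb51e8` (branch `main`, 2026-08-18; Lean v4.34.0-rc1 /
Mathlib `274ed6d6`), in its own `section`. Modifications made here: (1) back-port to Mathlib v4.32.0
(FLT-INVENTORY §3.2 probe E rule table): `module`/`public import`/`@[expose] public section` removed,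
`Set.mem_ofPred_eq` ↦ `Set.mem_setOf_eq`; (2) the declarations listed above OMITTED; (3) docstrings and
provenance tags added to every declaration; the original copyright header is kept above.
NAMESPACES (CONVENTIONS §2, reviews p318962/p319167): this file has no FLT root-level declarations (the
packet namespace `Literature.NumberTheory.AdelicBaseChange` is merely opened at the top, as in every
packet file); FLT's deliberate extensions of MATHLIB namespaces — here `RestrictedProduct`, `Continuous`
— keep their absolute names for dot notation, and each such docstring says so. Short names are FLT's
throughout, so that the later files of the packet, and an eventual Mathlib bump absorbing FLT's
upstreaming, need no renaming; none of them exists in Mathlib v4.32.0 or in the tree.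

## References
* K. Buzzard, R. Taylor et al., *FLT* (Lean 4 project), Imperial College London, 2025–. [FLTProject2025]
-/

namespace Literature.NumberTheory.AdelicBaseChange
-- the packet namespace (CONVENTIONS §2): FLT-root declarations below live in it; it is opened here so
-- that FLT's cross-references between them and its Mathlib-namespace extensions resolve unchanged.
end Literature.NumberTheory.AdelicBaseChange

open Literature.NumberTheory.AdelicBaseChange

/-! ## From `FLT/Mathlib/Topology/Algebra/RestrictedProduct/TopologicalSpace.lean` -/

section

open RestrictedProduct

variable {ι : Type*}
variable {ℱ : Filter ι}
    {G H : ι → Type*}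
    {C : (i : ι) → Set (G i)}
    {D : (i : ι) → Set (H i)}

variable [Π i, TopologicalSpace (G i)] [Π i, TopologicalSpace (H i)] in
/-- A componentwise map of restricted products `map φ hφ` is continuous when every `φ i` is.
(In Mathlib's namespace `Continuous`: a deliberate extension under FLT's name, for dot notation and
so that the later packet files apply unchanged — CONVENTIONS §2.)
[cite: FLTProject2025, FLT/Mathlib/Topology/Algebra/RestrictedProduct/TopologicalSpace.lean · Continuous.restrictedProduct_congrRight] -/
@[fun_prop]
theorem Continuous.restrictedProduct_congrRight {φ : (i : ι) → G i → H i}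
    (hφ : ∀ᶠ i in ℱ, Set.MapsTo (φ i) (C i) (D i))
    (hφcont : ∀ i, Continuous (φ i)) :
    Continuous (map φ hφ) :=
  mapAlong_continuous G H id Filter.tendsto_id φ hφ hφcont

/-- The underlying function of a finite sum in a restricted product is the sum of the underlying
functions.
(In Mathlib's namespace `RestrictedProduct`: a deliberate extension under FLT's name, for dot
notation and so that the later packet files apply unchanged — CONVENTIONS §2.)
[cite: FLTProject2025, FLT/Mathlib/Topology/Algebra/RestrictedProduct/TopologicalSpace.lean · RestrictedProduct.coe_sum] -/
@[simp]
lemma RestrictedProduct.coe_sum {ι : Type*} {A S : ι → Type*} [∀ i, SetLike (S i) (A i)]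
    [∀ i, AddCommMonoid (A i)] [∀ i, AddSubmonoidClass (S i) (A i)] {C : ∀ i, S i} {ℱ : Filter ι}
    {σ : Type*} (s : Finset σ)
    (f : σ → Πʳ i, [A i, C i]_[ℱ]) : ⇑(∑ i ∈ s, f i) = ∑ i ∈ s, ⇑(f i) :=
  map_sum (RestrictedProduct.coeAddMonoidHom ..) ..

/-- Components of a finite sum in a restricted product: `(∑ i ∈ s, f i) j = ∑ i ∈ s, f i j`.
(In Mathlib's namespace `RestrictedProduct`: a deliberate extension under FLT's name, for dot
notation and so that the later packet files apply unchanged — CONVENTIONS §2.)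
[cite: FLTProject2025, FLT/Mathlib/Topology/Algebra/RestrictedProduct/TopologicalSpace.lean · RestrictedProduct.sum_apply] -/
lemma RestrictedProduct.sum_apply {ι : Type*} {A S : ι → Type*} [∀ i, SetLike (S i) (A i)]
    [∀ i, AddCommMonoid (A i)] [∀ i, AddSubmonoidClass (S i) (A i)] {C : ∀ i, S i} {ℱ : Filter ι}
    {σ : Type*} (s : Finset σ)
    (f : σ → Πʳ i, [A i, C i]_[ℱ]) (j) : (∑ i ∈ s, f i) j = ∑ i ∈ s, f i j := by simp

section flatten

variable {ι₂ : Type*} {𝒢 : Filter ι₂} {f : ι → ι₂} (C)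
variable (hf : Filter.comap f 𝒢 = ℱ)

namespace RestrictedProduct

variable [Π i, TopologicalSpace (G i)]

/-- The canonical homeomorphism from a restricted product of products over fibres of a map on
indexing sets to the restricted product over the original indexing set.
(In Mathlib's namespace `RestrictedProduct`: a deliberate extension under FLT's name, for dot
notation and so that the later packet files apply unchanged — CONVENTIONS §2.)
[cite: FLTProject2025, FLT/Mathlib/Topology/Algebra/RestrictedProduct/TopologicalSpace.lean · RestrictedProduct.flattenHomeomorph] -/
def flattenHomeomorph :
    Πʳ j, [Π (i : f ⁻¹' {j}), G i, Set.pi Set.univ (fun (i : f ⁻¹' {j}) => C i)]_[𝒢] ≃ₜ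
    Πʳ i, [G i, C i]_[ℱ] where
  __ := flattenEquiv C hf
  continuous_toFun := by
    dsimp only [flattenEquiv]
    apply mapAlong_continuous
    fun_prop
  continuous_invFun := by
    dsimp only [flattenEquiv]
    rw [continuous_dom]
    intro S hS
    set T := (f '' Sᶜ)ᶜ with hTval
    have hT : 𝒢 ≤ Filter.principal T := by
      rwa [Filter.le_principal_iff, hTval, ← Filter.mem_comap_iff_compl, hf,
        ← Filter.le_principal_iff]
    let g : Πʳ i, [G i, C i]_[Filter.principal S] → Πʳ j, [Π (i : f ⁻¹' {j}), G i,
        Set.pi Set.univ (fun (i : f ⁻¹' {j}) => C i)]_[Filter.principal T] :=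
      fun x ↦ ⟨fun _ i ↦ x i, by
        have : Filter.comap f (Filter.principal T) ≤ Filter.principal S := by
          rw [Filter.le_principal_iff, Filter.mem_comap]
          use T
          refine ⟨Filter.mem_principal_self T, ?_⟩
          rw [hTval, Set.preimage_compl, Set.compl_subset_comm]
          apply Set.subset_preimage_image
        have hx := Filter.Eventually.filter_mono this x.prop
        rw [Filter.eventually_comap] at hx
        filter_upwards [hx] with j hj ⟨i, hi⟩ _ using hj i hi⟩
    let hg: Continuous g := by
      rw [continuous_rng_of_principal]
      unfold g
      fun_prop
    apply (continuous_inclusion hT).comp hg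

/-- Components of `flattenHomeomorph`.
(In Mathlib's namespace `RestrictedProduct`: a deliberate extension under FLT's name, for dot
notation and so that the later packet files apply unchanged — CONVENTIONS §2.)
[cite: FLTProject2025, FLT/Mathlib/Topology/Algebra/RestrictedProduct/TopologicalSpace.lean · RestrictedProduct.flatten_homeomorph_apply] -/
@[simp]
lemma flatten_homeomorph_apply (x) (i : ι) :
    flattenHomeomorph C hf x i = x (f i) ⟨i, rfl⟩ :=
  rfl

/-- Components of `flattenHomeomorph.symm`.
(In Mathlib's namespace `RestrictedProduct`: a deliberate extension under FLT's name, for dot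
notation and so that the later packet files apply unchanged — CONVENTIONS §2.)
[cite: FLTProject2025, FLT/Mathlib/Topology/Algebra/RestrictedProduct/TopologicalSpace.lean · RestrictedProduct.flatten_homeomorph_symm_apply] -/
@[simp]
lemma flatten_homeomorph_symm_apply (x) (i : ι₂) (j : f ⁻¹' {i}) :
    (flattenHomeomorph C hf).symm x i j = x j.1 :=
  rfl

variable (hf : Filter.Tendsto f Filter.cofinite Filter.cofinite)

/-- The homeomorphism given by `flatten` when both restricted products are over the cofinite
filter and there's a topology on the factors.
(In Mathlib's namespace `RestrictedProduct`: a deliberate extension under FLT's name, for dot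
notation and so that the later packet files apply unchanged — CONVENTIONS §2.)
[cite: FLTProject2025, FLT/Mathlib/Topology/Algebra/RestrictedProduct/TopologicalSpace.lean · RestrictedProduct.flattenHomeomorph'] -/
def flattenHomeomorph' :
    Πʳ j, [Π (i : f ⁻¹' {j}), G i, Set.pi Set.univ (fun (i : f ⁻¹' {j}) => C i)] ≃ₜ
    Πʳ i, [G i, C i] :=
  flattenHomeomorph C <|
    le_antisymm (Filter.comap_cofinite_le f) (Filter.map_le_iff_le_comap.mp hf)

/-- Components of `flattenHomeomorph'` (the cofinite case).
(In Mathlib's namespace `RestrictedProduct`: a deliberate extension under FLT's name, for dot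
notation and so that the later packet files apply unchanged — CONVENTIONS §2.)
[cite: FLTProject2025, FLT/Mathlib/Topology/Algebra/RestrictedProduct/TopologicalSpace.lean · RestrictedProduct.flatten_homeomorph'_apply] -/
@[simp]
lemma flatten_homeomorph'_apply (x) (i : ι) :
    flattenHomeomorph' C hf x i = x (f i) ⟨i, rfl⟩ :=
  rfl

/-- Components of `(flattenHomeomorph').symm`.
(In Mathlib's namespace `RestrictedProduct`: a deliberate extension under FLT's name, for dot
notation and so that the later packet files apply unchanged — CONVENTIONS §2.)
[cite: FLTProject2025, FLT/Mathlib/Topology/Algebra/RestrictedProduct/TopologicalSpace.lean · RestrictedProduct.flatten_homeomorph'_symm_apply] -/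
@[simp]
lemma flatten_homeomorph'_symm_apply (x) (i : ι₂) (j : f ⁻¹' {i}) :
    (flattenHomeomorph' C hf).symm x i j = x j.1 :=
  rfl

end RestrictedProduct

end flatten

section nhds

open scoped Filter

variable [Π i, TopologicalSpace (G i)]

/-- An explicit condition for a set to be in the neighborhood of `x : Πʳ i, [G i, C i]_[𝓟 T]`
in terms of a product of neighbourhoods on the factors.
(In Mathlib's namespace `RestrictedProduct`: a deliberate extension under FLT's name, for dot
notation and so that the later packet files apply unchanged — CONVENTIONS §2.)
[cite: FLTProject2025, FLT/Mathlib/Topology/Algebra/RestrictedProduct/TopologicalSpace.lean · RestrictedProduct.mem_nhds_iff_of_principal] -/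
lemma RestrictedProduct.mem_nhds_iff_of_principal {T : Set ι} {x : Πʳ i, [G i, C i]_[𝓟 T]}
    (U : Set Πʳ i, [G i, C i]_[𝓟 T]) :
    U ∈ nhds x ↔ ∃ (I : Set ι) (s : (i : ι) → Set (G i)), I.Finite ∧ (∀ i, s i ∈ nhds (x i)) ∧
    (↑) ⁻¹' I.pi s ⊆ U := by
  rw [isEmbedding_coe_of_principal.nhds_eq_comap, Filter.mem_comap, nhds_pi]
  simp_rw [Filter.mem_pi]
  exact ⟨fun ⟨t, ⟨I, hIf, s, hs, ht⟩, htU⟩ ↦ ⟨I, s, hIf, hs, by grw [ht, htU]⟩,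
    fun ⟨I, s, hIf, hs, hU⟩ ↦ ⟨I.pi s, ⟨I, hIf, s, hs, subset_rfl⟩, hU⟩⟩

/-- A condition for a set to be a neighborhood in `Πʳ i, [G i, C i]`, slightly weaker than the
condition in `mem_nhds_iff_of_cofinite`.
(In Mathlib's namespace `RestrictedProduct`: a deliberate extension under FLT's name, for dot
notation and so that the later packet files apply unchanged — CONVENTIONS §2.)
[cite: FLTProject2025, FLT/Mathlib/Topology/Algebra/RestrictedProduct/TopologicalSpace.lean · RestrictedProduct.mem_nhds_of_exists_nhds_of_cofinite] -/
lemma RestrictedProduct.mem_nhds_of_exists_nhds_of_cofinite {x : Πʳ i, [G i, C i]}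
    {U : Set Πʳ i, [G i, C i]} (hCopen : ∀ i, IsOpen (C i : Set (G i))) (s : (i : ι) → Set (G i))
    (hs : ∀ i, s i ∈ nhds (x i)) (hf : ∀ᶠ i in Filter.cofinite, C i ⊆ s i)
    (hU : (↑) ⁻¹' Set.univ.pi s ⊆ U) : U ∈ nhds x := by
  set I := {i | ¬C i ⊆ s i} with hIval
  set T := {i | x i ∉ C i} with hTval
  have hT : Filter.cofinite ≤ Filter.principal Tᶜ := by simpa using x.eventually
  have hT' : ∀ᶠ (i : ι) in Filter.principal Tᶜ, x i ∈ C i := by simp [hTval]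
  obtain ⟨x', hx⟩ := RestrictedProduct.exists_inclusion_eq_of_eventually G C hT hT'
  have hs' : ∀ i, s i ∈ nhds (x' i) := by simpa [← hx] using hs
  rw [← hx, nhds_eq_map_inclusion hCopen hT, Filter.mem_map, mem_nhds_iff_of_principal]
  refine ⟨I ∪ T, s, Set.Finite.union hf x.eventually, hs', ?_⟩
  grw [← hU, ← Set.preimage_comp, coe_comp_inclusion, ← Set.image_subset_iff,
      Set.image_preimage_eq_inter_range, range_coe_principal]
  rintro y hy i -
  simp only [Set.mem_inter_iff, Set.mem_pi] at hy
  by_cases h : i ∈ I ∪ T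
  · apply hy.left i h
  · simp only [Set.mem_union, not_or] at h
    have hy' : y i ∈ C i := hy.right i h.right
    simp only [hIval, Set.mem_setOf_eq, not_not] at h
    exact h.left hy'

/-- The classical condition for a set to be a neighborhood in the restricted product.
(In Mathlib's namespace `RestrictedProduct`: a deliberate extension under FLT's name, for dot
notation and so that the later packet files apply unchanged — CONVENTIONS §2.)
[cite: FLTProject2025, FLT/Mathlib/Topology/Algebra/RestrictedProduct/TopologicalSpace.lean · RestrictedProduct.mem_nhds_iff_of_cofinite] -/
lemma RestrictedProduct.mem_nhds_iff_of_cofinite {x : Πʳ i, [G i, C i]} {U : Set Πʳ i, [G i, C i]}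
    (hCopen : ∀ i, IsOpen (C i : Set (G i))) :
    U ∈ nhds x ↔ ∃ (s : (i : ι) → Set (G i)), (∀ i, s i ∈ nhds (x i)) ∧
    (∀ᶠ i in Filter.cofinite, s i = C i) ∧ Set.univ.pi s ⊆ (↑) '' U := by
  refine ⟨fun hn ↦ ?_, fun ⟨s, hs, hsf, hsU⟩ ↦ ?_⟩
  · set T := {i | x i ∉ C i} with hTval
    have hT : Filter.cofinite ≤ Filter.principal Tᶜ := by simpa using x.eventually
    have hT' : ∀ᶠ (i : ι) in Filter.principal Tᶜ, x i ∈ C i := by simp [hTval]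
    obtain ⟨x', hx⟩ := RestrictedProduct.exists_inclusion_eq_of_eventually G C hT hT'
    rw [← hx, nhds_eq_map_inclusion hCopen hT, Filter.mem_map, mem_nhds_iff_of_principal] at hn
    obtain ⟨I, s, hIf, hs, hU⟩ := hn
    refine ⟨fun i ↦ (s i ∪ {x | i ∉ I}) ∩ (C i ∪ {x | i ∈ T}), ?_, ?_, ?_⟩
    · intro i
      rw [← hx]
      apply Filter.inter_mem (Filter.mem_of_superset (hs i) Set.subset_union_left)
      apply IsOpen.mem_nhds (IsOpen.union (hCopen i) isOpen_const)
      rw [Set.mem_union, Set.mem_setOf_eq, or_iff_not_imp_right]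
      apply x'.eventually
    · filter_upwards [hIf.compl_mem_cofinite, x.eventually] with i (hI : i ∉ I) hC
      simp [hI, hC, hTval]
    · grw [← image_coe_preimage_inclusion_subset _ _ hT, ← hU, Set.image_preimage_eq_inter_range,
        range_coe_principal]
      simp [Set.subset_def, or_iff_not_imp_right, forall_and]
  · apply mem_nhds_of_exists_nhds_of_cofinite hCopen s hs
    · filter_upwards [hsf] with _ using superset_of_eq
    · exact Set.preimage_subset hsU DFunLike.coe_injective.injOn

end nhds

section openmap

variable [Π i, TopologicalSpace (G i)] [Π i, TopologicalSpace (H i)]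

/-- A componentwise map of restricted products (over cofinite filters related by `comap`) whose
components are open maps sending `C (f j)` ONTO `C₂ j` for almost all `j` is an open map.
(In Mathlib's namespace `RestrictedProduct`: a deliberate extension under FLT's name, for dot
notation and so that the later packet files apply unchanged — CONVENTIONS §2.)
[cite: FLTProject2025, FLT/Mathlib/Topology/Algebra/RestrictedProduct/TopologicalSpace.lean · RestrictedProduct.isOpenMap_of_open_components] -/
lemma RestrictedProduct.isOpenMap_of_open_components
    (hCopen : ∀ i, IsOpen (C i : Set (G i))) (hDopen : ∀ i, IsOpen (D i : Set (H i)))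
    (f : Πʳ i, [G i, C i] → Πʳ i, [H i, D i]) (g : (i : ι) → G i → H i)
    (hcomponent : ∀ x i, f x i = g i (x i)) (hg : ∀ i, IsOpenMap (g i))
    (hsurj : ∀ᶠ i in Filter.cofinite, Set.SurjOn (g i) (C i) (D i)) :
    IsOpenMap f := by
  refine IsOpenMap.of_nhds_le fun x ↦ Filter.le_map fun U hU ↦ ?_
  obtain ⟨s, hf, hs, hU⟩ := (mem_nhds_iff_of_cofinite hCopen).mp hU
  apply mem_nhds_of_exists_nhds_of_cofinite hDopen fun i ↦ (g i) '' (s i)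
  · intro i
    rw [hcomponent]
    exact IsOpenMap.image_mem_nhds (hg i) (hf i)
  · filter_upwards [hsurj, hs] with i hsurj' heq using heq ▸ hsurj'
  · apply Set.preimage_subset _ DFunLike.coe_injective.injOn
    grw [← Set.piMap_image_univ_pi, hU, ← Set.image_comp,
      ← Set.image_comp, ← components_comp_coe_eq_coe_apply hcomponent]
    rfl

end openmap

namespace RestrictedProduct

section single

variable {ι : Type*} [DecidableEq ι] {R : Type*} [Semiring R] (A : ι → Type*) {𝓕 : Filter ι}
    {S : ι → Type*}
    [(i : ι) → SetLike (S i) (A i)] {B : (i : ι) → S i} (j : ι) [(i : ι) → AddCommMonoid (A i)]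
    [(i : ι) → Module R (A i)] [∀ (i : ι), AddSubmonoidClass (S i) (A i)]

variable [∀ i, TopologicalSpace (A i)]
open Filter in
/--
The inclusion from a factor into the restricted product of topological additive groups,
as a continuous group homomorphism.
(In Mathlib's namespace `RestrictedProduct`: a deliberate extension under FLT's name, for dot
notation and so that the later packet files apply unchanged — CONVENTIONS §2.)
[cite: FLTProject2025, FLT/Mathlib/Topology/Algebra/RestrictedProduct/TopologicalSpace.lean · RestrictedProduct.singleContinuousAddMonoidHom] -/
noncomputable def singleContinuousAddMonoidHom (j : ι) : A j →ₜ+ Πʳ i, [A i, B i] where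
  __ := singleAddMonoidHom A j
  continuous_toFun := by
    let S : Set ι := {j}ᶜ
    let single' : A j → Πʳ i, [A i, B i]_[𝓟 S] :=
      fun x ↦ ⟨Pi.single j x,
        eventually_principal.mpr
        fun i hi ↦ by simp [Pi.single_eq_of_ne (Set.mem_compl_singleton_iff.mp hi)]⟩
    have : Continuous single' := by
      simpa [continuous_rng_of_principal] using! continuous_single j
    apply (isEmbedding_inclusion_principal
      (le_principal_iff.mpr (Set.finite_singleton j).compl_mem_cofinite)).continuous.comp this

/-- `singleContinuousAddMonoidHom A j x j = x`.
(In Mathlib's namespace `RestrictedProduct`: a deliberate extension under FLT's name, for dot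
notation and so that the later packet files apply unchanged — CONVENTIONS §2.)
[cite: FLTProject2025, FLT/Mathlib/Topology/Algebra/RestrictedProduct/TopologicalSpace.lean · RestrictedProduct.singleContinuousAddMonoidHom_apply_same] -/
lemma singleContinuousAddMonoidHom_apply_same {j : ι} (x : A j) :
    (singleContinuousAddMonoidHom A j x : Πʳ i, [A i, B i]) j = x :=
  Pi.single_eq_same j x

/-- `singleContinuousAddMonoidHom A j x i = 0` for `i ≠ j`.
(In Mathlib's namespace `RestrictedProduct`: a deliberate extension under FLT's name, for dot
notation and so that the later packet files apply unchanged — CONVENTIONS §2.)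
[cite: FLTProject2025, FLT/Mathlib/Topology/Algebra/RestrictedProduct/TopologicalSpace.lean · RestrictedProduct.singleContinuousAddMonoidHom_apply_of_ne] -/
lemma singleContinuousAddMonoidHom_apply_of_ne {j i : ι} (h : i ≠ j) (x : A j) :
    (singleContinuousAddMonoidHom A j x : Πʳ i, [A i, B i]) i = 0 :=
  Pi.single_eq_of_ne h x

end single

section eval

variable {ι : Type*} [DecidableEq ι] {R : Type*} [Semiring R] (A : ι → Type*) {𝓕 : Filter ι}
    {S : ι → Type*}
    [(i : ι) → SetLike (S i) (A i)] {B : (i : ι) → S i} (j : ι) [(i : ι) → AddCommMonoid (A i)]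
    [(i : ι) → Module R (A i)] [∀ (i : ι), AddSubmonoidClass (S i) (A i)]

variable [∀ i, TopologicalSpace (A i)]

/-- The continuous additive projection from a restricted product of topological additive groups
to a factor.
(In Mathlib's namespace `RestrictedProduct`: a deliberate extension under FLT's name, for dot
notation and so that the later packet files apply unchanged — CONVENTIONS §2.)
[cite: FLTProject2025, FLT/Mathlib/Topology/Algebra/RestrictedProduct/TopologicalSpace.lean · RestrictedProduct.evalContinuousAddMonoidHom] -/
def evalContinuousAddMonoidHom (j : ι) : Πʳ i, [A i, B i] →ₜ+ A j := {
  __ := evalAddMonoidHom A j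
  continuous_toFun := continuous_eval j
}

end eval

end RestrictedProduct

end
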